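import Summits.FinalStateConjecture.FinalStateConjecture.Theorems.HonestFixedRadiusSettling.Negative.TruncatedMinkowski
import Summits.FinalStateConjecture.FinalStateConjecture.Theorems.HonestFixedRadiusSettling.Negative.KillShape
import Literature.Geometry.Lorentzian.IsometricImmersionExp
import Literature.Geometry.Lorentzian.CauchyProblemProofs
import Literature.Geometry.Lorentzian.GeodesicProofs
import Literature.Geometry.Lorentzian.TrivialDataAdmissible

/-!
# `HonestFixedRadiusSettling` (crux `stmt-FinalStateConjecture-13550`, route `StarvedNecks`):
# the maximality guard is load-bearing (negative-side support, part 2 of 2)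

The time-truncated Minkowski development `TruncatedMinkowski.development T hT` (part 1) has
INCOMPLETE future null infinity in the crux's own (sojourn) sense, so the crux's pointwise property
with the guard `𝒟.IsMaximal →` deleted already fails at the admissible trivial datum. Proved here,
no named facts, no `sorry`, axioms `propext · Classical.choice · Quot.sound`:

* `TruncatedMinkowski.isNormalisedNullRayFrom_ray` — from every point `(0, p)` of the data
  hypersurface, the straight null line `s ↦ (0, p) + s(∂ₜ + ∂₁)`, `s < T`, is a normalised future
  null ray of the slab and a MAXIMAL geodesic with affine domain `(-∞, T)`
  (`isMaximalGeodesicOn_ray`: a geodesic extension across `T` is continuous at `T` with value in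
  the slab, while the line tends to a point of time `T`; geodesics of the open sub-spacetime are
  the ambient straight lines, `PseudoRiemannianMetric.isGeodesicOn_restrict_iff` and
  `ModelSpace.isGeodesic_line`, O'Neill 1983, Ch. 3, Example 25);
* `TruncatedMinkowski.not_hasCompleteNullInfinity_development` — every such ray has bounded affine
  domain and sojourn time `≤ vol((-∞, T) ∩ [0, ∞)) = T < T + 1` in every set: the "Minkowski
  truncated at `t < T` ✗" column of `NullInfinity.lean`, now a theorem about a constructed
  `VacuumCauchyDevelopment` of the trivial data; packaged as
  `exists_vacuumCauchyDevelopment_not_hasCompleteNullInfinity`;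
* `settlingSetWithoutIsMaximal` (the crux's `P` with `𝒟.IsMaximal →` deleted, Set-valued) and
  `trivialData_exceptional_withoutIsMaximal` — the admissible trivial datum is EXCEPTIONAL for the
  unguarded property, although every clause of the guarded `P` holds at the Minkowski development
  itself (crux `Disproof.lean` §6 `settlesAt_minkowski`): **any proof of the crux must use
  maximality of `𝒟`**, at the very least to exclude time truncations;
  `not_forall_hasCompleteNullInfinity_trivialData` — the same for the weak-cosmic-censorship core;
  `not_cruxWithoutIsMaximal_of_not_crux` — the unguarded generic statement is stronger than the
  crux; `curve_obligation_of_cruxWithoutIsMaximal` — what it would demand at the trivial datum (a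
  smooth admissible curve all of whose other members have ONLY complete-`𝓘⁺` developments; absurd on
  paper by time truncation, not refutable in a tree that constructs no development of any
  non-trivial datum).
* For the line `sojourn-needs-only-one-over-delta`: its certificate `Cert` (one atlas at infinity
  ⇒ complete `𝓘⁺`, stated for ALL developments) therefore implies that the slab carries no
  final-state decomposition with one atlas at infinity.

References: D. Christodoulou, CQG 16 (1999) A23, pp. A26–A27 and M. Dafermos, I. Rodnianski,
arXiv:0811.0354, §2.6.2 (completeness of `𝓘⁺`, sojourn form); B. O'Neill, 1983, Ch. 3,
Example 25 and p. 68 (maximal geodesics); J. Sbierski, AHP 17 (2016), Def. 2.4.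
-/

noncomputable section

set_option linter.dupNamespace false

open Literature.Geometry.Lorentzian
open scoped Manifold ContDiff ENNReal Topology
open Filter Set Bundle TopologicalSpace MeasureTheory

namespace Summit.FinalStateConjecture.FinalStateConjecture.Theorems.HonestFixedRadiusSettling.Negative

open Summit.FinalStateConjecture.FinalStateConjecture.Theses.StarvedNecks (HonestFixedRadiusSettling)

namespace TruncatedMinkowski

open Minkowski

/-! ### Incomplete null rays of the slab -/

/-- The null direction `∂ₜ + ∂₁`. -/
def nullDir : E4 := E4.basisVector 0 + E4.basisVector 1

/-- `(∂ₜ + ∂₁)⁰ = 1`. -/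
@[simp] theorem nullDir_apply_zero : nullDir 0 = 1 := by
  simp [nullDir]

/-- `(∂ₜ + ∂₁)¹ = 1`. -/
@[simp] theorem nullDir_apply_one : nullDir 1 = 1 := by
  simp [nullDir]

/-- `(∂ₜ + ∂₁)² = 0`. -/
@[simp] theorem nullDir_apply_two : nullDir 2 = 0 := by
  simp [nullDir]

/-- `(∂ₜ + ∂₁)³ = 0`. -/
@[simp] theorem nullDir_apply_three : nullDir 3 = 0 := by
  simp [nullDir]

/-- `∂ₜ + ∂₁` is `η`-null. -/
theorem bilin_nullDir_nullDir : Minkowski.bilin nullDir nullDir = 0 := by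
  rw [Minkowski.bilin_apply, Fin.sum_univ_three]
  have h0 : (0 : Fin 3).succ = (1 : Fin 4) := rfl
  have h1 : (1 : Fin 3).succ = (2 : Fin 4) := rfl
  have h2 : (2 : Fin 3).succ = (3 : Fin 4) := rfl
  rw [h0, h1, h2, nullDir_apply_zero, nullDir_apply_one, nullDir_apply_two, nullDir_apply_three]
  norm_num

/-- `η(∂ₜ, ∂ₜ + ∂₁) = -1`. -/
theorem bilin_basisVector_zero_nullDir : Minkowski.bilin (E4.basisVector 0) nullDir = -1 := by
  rw [bilin_basisVector_zero_left, nullDir_apply_zero]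

/-- `η(∂ₜ + ∂₁, ∂ₜ) = -1`. -/
theorem bilin_nullDir_basisVector_zero : Minkowski.bilin nullDir (E4.basisVector 0) = -1 := by
  rw [bilin_symm, bilin_basisVector_zero_nullDir]

/-- `∂ₜ + ∂₁ ≠ 0`. -/
theorem nullDir_ne_zero : nullDir ≠ 0 := by
  intro h
  have := congrArg (fun v : E4 ↦ v 0) h
  simp at this

/-- The straight null line `s ↦ (0, p) + s (∂ₜ + ∂₁)` of Minkowski space. -/
def line (p : Minkowski.slice) (s : ℝ) : E4 := (show E4 from 𝒟₀.embed p) + s • nullDir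

/-- The line starts at `(0, p)`. -/
theorem line_zero (p : Minkowski.slice) : line p 0 = 𝒟₀.embed p := by
  simp [line]

/-- The time coordinate along the line is the parameter. -/
theorem line_apply_zero (p : Minkowski.slice) (s : ℝ) : line p s 0 = s := by
  show (E4.ofTimeSpace 0 (p : E3) + s • nullDir) 0 = s
  rw [PiLp.add_apply, PiLp.smul_apply, E4.ofTimeSpace_apply_zero, nullDir_apply_zero]
  simp

/-- The line is continuous. -/
theorem continuous_line (p : Minkowski.slice) : Continuous (line p) :=
  continuous_const.add (continuous_id.smul continuous_const)

variable {T : ℝ}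

/-- The RAY of the slab from `(0, p)` in direction `∂ₜ + ∂₁`: the null line while it stays in the
slab (`s < T`), the junk value `(0, p)` afterwards. -/
def ray (hT : 0 < T) (p : Minkowski.slice) (s : ℝ) : slab T :=
  if h : s < T then ⟨line p s, show line p s 0 < T by rw [line_apply_zero]; exact h⟩
  else ⟨𝒟₀.embed p, embed_mem_slab hT p⟩

/-- Before time `T` the ray is the line. -/
theorem val_ray_of_lt (hT : 0 < T) (p : Minkowski.slice) {s : ℝ} (hs : s < T) :
    (ray hT p s).1 = line p s := by
  rw [ray, dif_pos hs]

/-- The ray agrees with the line on `(-∞, T)`. -/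
theorem eqOn_ray (hT : 0 < T) (p : Minkowski.slice) :
    EqOn (Subtype.val ∘ ray hT p) (line p) (Iio T) := fun _ hs ↦ val_ray_of_lt hT p hs

/-- The ray agrees with the line near every parameter `< T`. -/
theorem ray_eventuallyEq (hT : 0 < T) (p : Minkowski.slice) {s : ℝ} (hs : s < T) :
    (Subtype.val ∘ ray hT p) =ᶠ[𝓝 s] line p :=
  eventuallyEq_of_mem (isOpen_Iio.mem_nhds hs) (eqOn_ray hT p)

/-- The ray starts at the embedded data point `ι p`. -/
theorem ray_zero (hT : 0 < T) (p : Minkowski.slice) :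
    ray hT p 0 = 𝒟₀.embedOpens (slab T) (embed_mem_slab hT) p := by
  apply Subtype.ext
  rw [val_ray_of_lt hT p hT, line_zero]
  rfl

/-- The velocity of the ray at a parameter `s < T`, computed in the ambient `E4`, is `∂ₜ + ∂₁`. -/
theorem velocity_ray (hT : 0 < T) (p : Minkowski.slice) {s : ℝ} (hs : s < T) :
    (velocity 𝓘(ℝ, E4) (ray hT p) s : E4) = nullDir := by
  rw [← velocity_subtypeVal_comp (I := 𝓘(ℝ, E4)) (slab T) (ray hT p) s,
    velocity_congr_of_eventuallyEq (ray_eventuallyEq hT p hs)]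
  exact ModelSpace.velocity_line _ _ _

/-- The ambient Minkowski metric, as a pseudo-Riemannian metric. -/
abbrev gM := Minkowski.smoothMetric.toPseudoRiemannianMetric

/-- The restricted metric of the slab, as a pseudo-Riemannian metric. -/
abbrev gU (T : ℝ) := (gM).restrict PseudoRiemannianMetric.contMDiff_restrict_holds (slab T)

/-- The ambient metric has its Levi-Civita connection. -/
theorem hasLeviCivita_gM : (gM).HasLeviCivita := PseudoRiemannianMetric.hasLeviCivita _

/-- The restricted metric has its Levi-Civita connection. -/
theorem hasLeviCivita_gU (T : ℝ) : (gU T).HasLeviCivita := PseudoRiemannianMetric.hasLeviCivita _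

/-- The ray is a geodesic of the slab on `(-∞, T)` (straight lines are Minkowski geodesics; the
geodesics of an open sub-manifold are those of the ambient manifold lying in it). -/
theorem isGeodesicOn_ray (hT : 0 < T) (p : Minkowski.slice) :
    haveI := hasLeviCivita_gU T
    IsGeodesicOn (gU T).leviCivita (ray hT p) (Iio T) := by
  haveI := hasLeviCivita_gM
  haveI := hasLeviCivita_gU T
  rw [PseudoRiemannianMetric.isGeodesicOn_restrict_iff gM (slab T) isOpen_Iio]
  have hline : IsGeodesic (gM).leviCivita (line p) :=
    ModelSpace.isGeodesic_line (g := gM) (G₀ := Minkowski.bilin) smoothMetric_val _ _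
  exact IsGeodesicOn.congr_holds (hline.isGeodesicOn _) isOpen_Iio (eqOn_ray hT p).symm

/-- The ray is a MAXIMAL geodesic of the slab with domain `(-∞, T)`: a geodesic extension to an
open interval `s' ⊋ (-∞, T)` would be continuous at `T` with value in the slab, while along
`(-∞, T)` it tends to the point `(0, p) + T(∂ₜ + ∂₁)` of time coordinate `T`, outside the slab. -/
theorem isMaximalGeodesicOn_ray (hT : 0 < T) (p : Minkowski.slice) :
    haveI := hasLeviCivita_gU T
    IsMaximalGeodesicOn (gU T).leviCivita (ray hT p) (Iio T) := by
  haveI := hasLeviCivita_gU T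
  refine ⟨isOpen_Iio, ordConnected_Iio, isGeodesicOn_ray hT p, ?_⟩
  intro γ' s' hs'o hs'c hsub hγ' heq
  by_contra hne
  -- `s'` contains `T`
  obtain ⟨t, ht, htT⟩ : ∃ t ∈ s', T ≤ t := by
    by_contra hcon
    push Not at hcon
    exact hne (Subset.antisymm (fun t ht ↦ hcon t ht) hsub)
  have hT' : T ∈ s' := hs'c.out (hsub (show T - 1 ∈ Iio T by simp)) ht ⟨by linarith, htT⟩
  -- continuity of `γ'` at `T`
  have hcont : ContinuousAt (Subtype.val ∘ γ') T :=
    continuous_subtype_val.continuousAt.comp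
      (IsGeodesicOn.mdifferentiableAt_holds hγ' hT').continuousAt
  -- along `(-∞, T)` the extension is the line
  have h1 : Tendsto (Subtype.val ∘ γ') (𝓝[<] T) (𝓝 ((γ' T).1)) :=
    hcont.tendsto.mono_left nhdsWithin_le_nhds
  have h2 : Tendsto (Subtype.val ∘ γ') (𝓝[<] T) (𝓝 (line p T)) := by
    have hl : Tendsto (line p) (𝓝[<] T) (𝓝 (line p T)) :=
      ((continuous_line p).tendsto T).mono_left nhdsWithin_le_nhds
    refine hl.congr' ?_
    filter_upwards [self_mem_nhdsWithin] with t ht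
    show line p t = (γ' t).1
    rw [← heq ht]
    exact (val_ray_of_lt hT p ht).symm
  have hlim : (γ' T).1 = line p T := tendsto_nhds_unique h1 h2
  have hmem : (show E4 from (γ' T).1) 0 < T := (γ' T).2
  rw [hlim, line_apply_zero] at hmem
  exact lt_irrefl _ hmem

/-- **The ray is a normalised future null ray of the truncated development from `p`**: maximal
geodesic on `(-∞, T) ∋ 0`, starting at `ι p = (0, p)`, with initial velocity `∂ₜ + ∂₁` — null,
future-directed (`η(∂ₜ, ∂ₜ + ∂₁) = -1 < 0`) and normalised against the unit normal `∂ₜ`. -/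
theorem isNormalisedNullRayFrom_ray (hT : 0 < T) (p : Minkowski.slice) :
    haveI : (development T hT).metric.HasLeviCivita := hasLeviCivita_gU T
    (development T hT).metric.IsNormalisedNullRayFrom (development T hT).timeOrientation
      (development T hT).embed (development T hT).normal p (ray hT p) (Iio T) := by
  haveI hLC : (development T hT).metric.HasLeviCivita := hasLeviCivita_gU T
  have hv : (velocity 𝓘(ℝ, E4) (ray hT p) 0 : E4) = nullDir := velocity_ray hT p hT
  refine ⟨?_, hT, ray_zero hT p, ⟨?_, ?_⟩, ⟨⟨?_, ?_⟩, ?_⟩, ?_⟩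
  · exact isMaximalGeodesicOn_ray hT p
  · change Minkowski.bilin (velocity 𝓘(ℝ, E4) (ray hT p) 0) (velocity 𝓘(ℝ, E4) (ray hT p) 0) = 0
    rw [hv]
    exact bilin_nullDir_nullDir
  · change (velocity 𝓘(ℝ, E4) (ray hT p) 0 : E4) ≠ 0
    rw [hv]
    exact nullDir_ne_zero
  · change Minkowski.bilin (velocity 𝓘(ℝ, E4) (ray hT p) 0) (velocity 𝓘(ℝ, E4) (ray hT p) 0) ≤ 0
    rw [hv, bilin_nullDir_nullDir]
  · change (velocity 𝓘(ℝ, E4) (ray hT p) 0 : E4) ≠ 0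
    rw [hv]
    exact nullDir_ne_zero
  · change Minkowski.bilin (E4.basisVector 0) (velocity 𝓘(ℝ, E4) (ray hT p) 0) < 0
    rw [hv, bilin_basisVector_zero_nullDir]
    norm_num
  · change Minkowski.bilin (velocity 𝓘(ℝ, E4) (ray hT p) 0) (E4.basisVector 0) = -1
    rw [hv]
    exact bilin_nullDir_basisVector_zero

/-- The Minkowski slice `ℝ³` is not covered by a compact set. -/
theorem exists_not_mem_of_isCompact {B : Set Minkowski.slice} (hB : IsCompact B) : ∃ p, p ∉ B := by
  by_contra hcon
  push Not at hcon
  have huniv : B = univ := eq_univ_of_forall hcon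
  have hc : IsCompact (Subtype.val '' B) := hB.image continuous_subtype_val
  rw [huniv, image_univ, Subtype.range_coe_subtype] at hc
  have hset : {x : E3 | x ∈ Minkowski.slice} = univ := by
    ext x
    simp
  rw [hset] at hc
  exact noncompact_univ E3 hc

/-- **The time-truncated Minkowski development has INCOMPLETE future null infinity** (sojourn
form): for `s = T + 1` and any compact `B₁`, the ray from a point `p ∉ B₁` has affine domain
`(-∞, T)` — bounded above — and sojourn time `≤ vol((-∞, T) ∩ [0, ∞)) = T < T + 1` in every
set. This is the "Minkowski truncated at `t < T` — ✗" column of `NullInfinity.lean`, now a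
theorem about a constructed `VacuumCauchyDevelopment` of the trivial data. -/
theorem not_hasCompleteNullInfinity_development (hT : 0 < T) :
    ¬ HasCompleteNullInfinity (development T hT).toCauchyDevelopment := by
  intro h
  have inst : (development T hT).metric.HasLeviCivita := hasLeviCivita_gU T
  obtain ⟨B₀, -, hB₀⟩ := @h inst
  obtain ⟨B₁, hB₁, hray⟩ := hB₀ (T + 1) (by linarith)
  obtain ⟨p, hp⟩ := exists_not_mem_of_isCompact hB₁
  rcases hray p hp (ray hT p) (Iio T) (isNormalisedNullRayFrom_ray hT p) with hbd | hsoj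
  · exact hbd bddAbove_Iio
  · have hle := hsoj.trans (sojournTime_le_volume _ _ _)
    have hvol : volume (Iio T ∩ Ici (0 : ℝ)) = ENNReal.ofReal T := by
      rw [Set.inter_comm, Set.Ici_inter_Iio, Real.volume_Ico, sub_zero]
    rw [hvol] at hle
    have := (ENNReal.ofReal_le_ofReal_iff hT.le).1 hle
    linarith

/-- Packaged: **the trivial data have a vacuum Cauchy development with incomplete `𝓘⁺`.** -/
theorem exists_vacuumCauchyDevelopment_not_hasCompleteNullInfinity :
    ∃ 𝒟 : VacuumCauchyDevelopment trivialData, ¬ HasCompleteNullInfinity 𝒟.toCauchyDevelopment :=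
  ⟨development 1 one_pos, not_hasCompleteNullInfinity_development one_pos⟩

/-- The truncated development is not an honest development in the sense of the crux (it already
fails the complete-`𝓘⁺` conjunct of `honestDevelopments`). -/
theorem development_not_mem_honestDevelopments (hT : 0 < T) :
    development T hT ∉ honestDevelopments trivialData :=
  fun h ↦ not_hasCompleteNullInfinity_development hT h.1

end TruncatedMinkowski

/-! ### The maximality guard of the crux is load-bearing -/

section WithoutIsMaximal

variable (X : Type) [TopologicalSpace X] [ChartedSpace E3 X] [IsManifold (𝓡 3) ∞ X] [ConnectedSpace X]

/-- The crux's pointwise property `P` with the guard `𝒟.IsMaximal →` DELETED from its universal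
conjunct: an MGHD exists, and EVERY vacuum Cauchy development (maximal or not) has complete `𝓘⁺` and
an honest `C⁴` fixed-radius decomposition of its self-determined exterior. -/
def settlingSetWithoutIsMaximal : Set (InitialDataSet (𝓡 3) X) :=
  {D | (∃ 𝒟 : VacuumCauchyDevelopment D, 𝒟.IsMaximal) ∧
    ∀ 𝒟 : VacuumCauchyDevelopment D, 𝒟 ∈ honestDevelopments D}

/-- The unguarded property implies the crux's property `P` pointwise (it is stronger). -/
theorem settlingSetWithoutIsMaximal_subset_settlingSet :
    settlingSetWithoutIsMaximal X ⊆ settlingSet X :=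
  fun _ h ↦ ⟨h.1, fun 𝒟 _ ↦ h.2 𝒟⟩

end WithoutIsMaximal

/-- `HonestFixedRadiusSettling` WITHOUT the maximality guard — Christodoulou-genericity of the
unguarded property, written inline (no `def … : Prop` in a Theorems file) — is STRONGER than the
crux (genericity is monotone in the property): stated negatively, any refutation of the crux refutes
the unguarded version. The unguarded version is not refutable in the tree (that needs bad
developments of every admissible datum near the trivial one, and no development of any non-trivial
datum is constructed); on paper it is plainly false: truncate any development in time. -/
theorem not_cruxWithoutIsMaximal_of_not_crux (hn : ¬ HonestFixedRadiusSettling) :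
    ¬ ∀ (X : Type) [TopologicalSpace X] [ChartedSpace E3 X] [IsManifold (𝓡 3) ∞ X] [T2Space X]
      [SecondCountableTopology X] [ConnectedSpace X],
      InitialDataSet.IsChristodoulouGeneric (admissibleVacuumData X)
        (· ∈ settlingSetWithoutIsMaximal X) 1 := by
  intro h
  apply hn
  rw [crux_iff]
  intro X _ _ _ _ _ _
  exact isChristodoulouGeneric_mono (fun D _ hD ↦ settlingSetWithoutIsMaximal_subset_settlingSet X hD)
    (h X)

/-- **The maximality guard is load-bearing: without it the TRIVIAL DATA are exceptional.** The
admissible datum `(ℝ³, δ, 0)` (tree: `trivialData_mem_admissibleVacuumData`) does not have the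
unguarded property, because its time-truncated Minkowski development has incomplete `𝓘⁺`
(`TruncatedMinkowski.not_hasCompleteNullInfinity_development`). By contrast every clause of the
GUARDED property holds at the Minkowski development itself (Disproof §6 `settlesAt_minkowski`), so
any proof of the crux must use `𝒟.IsMaximal` — at the very least to exclude time truncations. -/
theorem trivialData_exceptional_withoutIsMaximal :
    trivialData ∈ admissibleVacuumData Minkowski.slice ∧
      trivialData ∉ settlingSetWithoutIsMaximal Minkowski.slice :=
  ⟨trivialData_mem_admissibleVacuumData, fun h ↦
    TruncatedMinkowski.development_not_mem_honestDevelopments one_pos (h.2 _)⟩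

/-- The same for the weak-cosmic-censorship core: "every vacuum Cauchy development of the trivial
data has complete `𝓘⁺`" is FALSE (whereas the guarded `censoredSet` is expected to contain the
trivial data: the Minkowski MGHD is null geodesically complete, Disproof §6). -/
theorem not_forall_hasCompleteNullInfinity_trivialData :
    ¬ ∀ 𝒟 : VacuumCauchyDevelopment trivialData, HasCompleteNullInfinity 𝒟.toCauchyDevelopment :=
  fun h ↦ TruncatedMinkowski.not_hasCompleteNullInfinity_development one_pos (h _)

/-- Consequently, under `CruxWithoutIsMaximal` the trivial datum would need a smooth injective
admissible curve through it ALL of whose other members have only complete-`𝓘⁺` developments — the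
explicit (absurd on paper) obligation that the unguarded statement creates at the simplest datum. -/
theorem curve_obligation_of_cruxWithoutIsMaximal
    (h : ∀ (X : Type) [TopologicalSpace X] [ChartedSpace E3 X] [IsManifold (𝓡 3) ∞ X] [T2Space X]
      [SecondCountableTopology X] [ConnectedSpace X],
      InitialDataSet.IsChristodoulouGeneric (admissibleVacuumData X)
        (· ∈ settlingSetWithoutIsMaximal X) 1) :
    ∃ F : EuclideanSpace ℝ (Fin 1) → InitialDataSet (𝓡 3) Minkowski.slice,
      InitialDataSet.IsSmoothDataFamily 1 F ∧ F 0 = trivialData ∧ Function.Injective F ∧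
        (∀ c, F c ∈ admissibleVacuumData Minkowski.slice) ∧
        ∀ c, c ≠ 0 → ∀ 𝒟 : VacuumCauchyDevelopment (F c),
          HasCompleteNullInfinity 𝒟.toCauchyDevelopment := by
  obtain ⟨F, hF, h0, hinj, hmem, hE⟩ := h Minkowski.slice trivialData
    ⟨trivialData_mem_admissibleVacuumData, trivialData_exceptional_withoutIsMaximal.2⟩
  refine ⟨F, hF, h0, hinj, hmem, fun c hc 𝒟 ↦ ?_⟩
  by_contra hcon
  exact hE c hc ⟨hmem c, fun hP ↦ hcon (hP.2 𝒟).1⟩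

end Summit.FinalStateConjecture.FinalStateConjecture.Theorems.HonestFixedRadiusSettling.Negative

end
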